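import Summits.CriticalPhenomena.SAWScalingLimit.Theorems.ShellCrossingBound.Negative.BulkEndpoint

/-!
# `ShellCrossingBound` — negative knowledge (cycle 2, part 2/2): bulk Aizenman–Burchard (H1) with a FIXED threshold `k₀ ≤ 2` is false

Support file for crux `stmt-CriticalPhenomena-4728` (refuter `cdisprove`, cycle 2; work file
`Summits/CriticalPhenomena/SAWScalingLimit/Cruxes/ShellCrossingBound/Disproof.lean`). Everything is
proved (no `sorry`; axioms `propext, Classical.choice, Quot.sound`).

Cycle 1 (`OfEventualTight`, `UniformThresholdFalse`) showed: with a shell-dependent threshold the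
crux collapses onto the target `EventualTight`; with ONE threshold on ALL shells it is false by
boundary forcing; the content-bearing repair is the BULK statement — one threshold `k₀` on interior
shells `closedBall x R ⊆ Ω` (the work file's `ShellCrossingBoundBulk`, inlined below with the
threshold `k₀` displayed). This file proves, ESTIMATE-FREE, that the bulk statement is false for
every `k₀ ≤ 2` (`Bulk.not_bulkThreshold_of_le_two`): the minimal admissible uniform
threshold is `≥ 3` (and is predicted to be `4`, the `k₀ = 3` case failing near the starting point
by the SAW return exponent `x₃ − x₁ = 3/2 < 2`, which is not provable today).

Mechanism (INTERIOR ENDPOINTS): `SAW.IsEndpointApprox` only asks `δ·b_δ → b`, so the lattice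
endpoint may sit at distance `≍ √δ ≫ δ` from `∂Ω` (`Bulk.bInt` of part 1 `BulkEndpoint.lean`, in the explicit Dobrushin domain
`Forcing.forcingDomain` of cycle 1, joined to cycle 1's `aδ`). Every SAW polyline ends at
`q = δ·b_δ`, so it crosses the circle `|z − q| = t`, `t = √δ/16`, and therefore passes within
`ρ = δ` of one of the `≤ 81 (t/ρ)²` points of a square grid of step `ρ/2` around `q`; for that grid
point `x` the walk makes TWO separate traversals of the interior shell `D(x; ρ, t/2) ⊆ Ω` (in from
the far start, out to the endpoint `q` at distance `≥ t/2`). The union bound turns the bulk bound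
`K (ρ/R)^λ` into `1 ≤ 324 K (2ρ/t)^{λ−2} = 324 K (32 √δ)^{λ−2} → 0` (`λ > 2`): contradiction.
Message for the planner: a fixed-threshold bulk crux needs `k₀ ≥ 3`; the latitude of
`IsEndpointApprox` (interior endpoints) is what bites at `k₀ = 2`, and bites the `k₀ = 3` case
conjecturally. [folklore]
-/

noncomputable section

open Set Filter Topology Metric MeasureTheory Complex
open scoped ENNReal Real unitInterval
open Literature.Probability.RandomPlanarGeometry Literature.Probability.LatticeModels

namespace Summit.CriticalPhenomena.SAWScalingLimit.Theorems.ShellCrossingBound.Negative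

namespace Bulk

open Forcing

/-! ## 3. Grid covering: every curve ending at `q` passes `ρ`-close to a grid point on its way in -/

/-- Just before a time `m > s` the curve is close to `γ m` (continuity). [folklore] -/
theorem exists_lt_dist_lt (γ : Curve ℂ) {s m : I} (hsm : s < m) {ε : ℝ} (hε : 0 < ε) :
    ∃ m' : I, s ≤ m' ∧ m' < m ∧ dist (γ m') (γ m) < ε := by
  obtain ⟨η, hη, hηε⟩ := Metric.continuousAt_iff.1 (γ.continuous.continuousAt (x := m)) ε hε
  have hsm' : (s : ℝ) < m := hsm
  set c : ℝ := max (s : ℝ) ((m : ℝ) - η / 2) with hc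
  have hcm : c < m := max_lt hsm' (by linarith)
  have hc01 : c ∈ Set.Icc (0 : ℝ) 1 := ⟨s.2.1.trans (le_max_left _ _), hcm.le.trans m.2.2⟩
  refine ⟨⟨c, hc01⟩, ?_, hcm, hηε ?_⟩
  · show (s : ℝ) ≤ c
    rw [hc]; exact le_max_left _ _
  rw [Subtype.dist_eq, Real.dist_eq, abs_sub_comm, abs_of_pos (by simpa using hcm)]
  have : (m : ℝ) - η / 2 ≤ c := le_max_right _ _
  show (m : ℝ) - c < η
  linarith

/-- A curve starting at distance `> t` from `q` and ending at `q` passes the circle `|z − q| = t`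
at a positive time. [folklore] -/
theorem exists_dist_eq (γ : Curve ℂ) {q : ℂ} (hq : γ 1 = q) {t : ℝ} (ht : 0 ≤ t)
    (h0 : t < dist (γ 0) q) : ∃ u : I, 0 < u ∧ dist (γ u) q = t := by
  set g : ℝ → ℝ := fun u => dist (γ (Set.projIcc (0 : ℝ) 1 zero_le_one u)) q with hg
  have hgc : Continuous g := (γ.continuous.comp continuous_projIcc).dist continuous_const
  have hg0 : g 0 = dist (γ 0) q := by simp [hg, Set.projIcc]
  have hg1 : g 1 = 0 := by
    have : g 1 = dist (γ 1) q := by simp [hg, Set.projIcc]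
    rw [this, hq, dist_self]
  have hmem : t ∈ g '' Set.Icc (0 : ℝ) 1 :=
    intermediate_value_Icc' zero_le_one hgc.continuousOn ⟨by rw [hg1]; exact ht, by rw [hg0]; exact h0.le⟩
  obtain ⟨c, hc, hgc'⟩ := hmem
  refine ⟨⟨c, hc⟩, ?_, ?_⟩
  · rcases eq_or_lt_of_le hc.1 with h | h
    · exfalso
      have : g c = dist (γ 0) q := by rw [← h]; exact hg0
      linarith
    · exact h
  · have : g c = dist (γ ⟨c, hc⟩) q := by simp [hg, Set.projIcc_of_mem _ hc]
    rw [← this, hgc']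

/-- The square grid of step `h` and index radius `N` about `q`. [folklore] -/
def gridPt (q : ℂ) (h : ℝ) (mn : ℤ × ℤ) : ℂ := q + ⟨h * mn.1, h * mn.2⟩

/-- The grid as a finite set of points. [folklore] -/
def grid (q : ℂ) (h : ℝ) (N : ℕ) : Finset ℂ :=
  ((Finset.Icc (-(N : ℤ)) N) ×ˢ (Finset.Icc (-(N : ℤ)) N)).image (gridPt q h)

/-- The grid has at most `(2N+1)²` points. [folklore] -/
theorem card_grid_le (q : ℂ) (h : ℝ) (N : ℕ) : ((grid q h N).card : ℝ) ≤ (2 * N + 1) ^ 2 := by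
  have h1 : (grid q h N).card ≤ ((Finset.Icc (-(N : ℤ)) N) ×ˢ (Finset.Icc (-(N : ℤ)) N)).card :=
    Finset.card_image_le
  rw [Finset.card_product, Int.card_Icc] at h1
  have h2 : ((N : ℤ) + 1 - -(N : ℤ)).toNat = 2 * N + 1 := by omega
  rw [h2] at h1
  have : ((grid q h N).card : ℝ) ≤ ((2 * N + 1) * (2 * N + 1) : ℕ) := by exact_mod_cast h1
  simpa [sq] using this

/-- Grid points are within `2 h N` of the centre. [folklore] -/
theorem dist_le_of_mem_grid {q x : ℂ} {h : ℝ} (hh : 0 ≤ h) {N : ℕ} (hx : x ∈ grid q h N) :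
    dist x q ≤ 2 * h * N := by
  simp only [grid, Finset.mem_image, Finset.mem_product, Finset.mem_Icc] at hx
  obtain ⟨⟨m, n⟩, ⟨⟨hm1, hm2⟩, hn1, hn2⟩, rfl⟩ := hx
  have hm : |(m : ℝ)| ≤ N := by
    rw [abs_le]; constructor <;> exact_mod_cast (by omega : _)
  have hn : |(n : ℝ)| ≤ N := by
    rw [abs_le]; constructor <;> exact_mod_cast (by omega : _)
  refine (dist_le_abs_re_add_abs_im _ _).trans ?_
  simp only [gridPt, add_re, add_im, add_sub_cancel_left, abs_mul, abs_of_nonneg hh]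
  nlinarith [mul_le_mul_of_nonneg_left hm hh, mul_le_mul_of_nonneg_left hn hh]

/-- Rounding: every point within `t` of the centre is within `h` of a grid point, provided
`t / h + 1 ≤ N`. [folklore] -/
theorem exists_mem_grid_dist_le {q z : ℂ} {h t : ℝ} (hh : 0 < h) {N : ℕ} (hN : t / h + 1 ≤ N)
    (hz : dist z q ≤ t) : ∃ x ∈ grid q h N, dist z x ≤ h := by
  set m : ℤ := round ((z.re - q.re) / h) with hm
  set n : ℤ := round ((z.im - q.im) / h) with hn
  have hre : |z.re - q.re| ≤ t := (abs_re_le_norm (z - q)).trans (by rwa [← Complex.dist_eq])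
  have him : |z.im - q.im| ≤ t := (abs_im_le_norm (z - q)).trans (by rwa [← Complex.dist_eq])
  have key : ∀ {w : ℝ}, |w| ≤ t → |(round (w / h) : ℝ)| ≤ N := by
    intro w hw
    have h1 : |w / h - round (w / h)| ≤ 1 / 2 := abs_sub_round _
    have h2 : |w / h| ≤ t / h := by rw [abs_div, abs_of_pos hh]; exact div_le_div_of_nonneg_right hw hh.le
    have h3 : |(round (w / h) : ℝ)| ≤ |w / h| + 1 / 2 := by
      have := abs_sub_abs_le_abs_sub (round (w / h) : ℝ) (w / h)
      rw [abs_sub_comm] at this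
      linarith
    linarith
  have hmN := key hre
  have hnN := key him
  rw [abs_le] at hmN hnN
  refine ⟨gridPt q h (m, n), ?_, ?_⟩
  · simp only [grid, Finset.mem_image, Finset.mem_product, Finset.mem_Icc]
    refine ⟨(m, n), ⟨⟨?_, ?_⟩, ?_, ?_⟩, rfl⟩
    · exact_mod_cast hmN.1
    · exact_mod_cast hmN.2
    · exact_mod_cast hnN.1
    · exact_mod_cast hnN.2
  · refine (dist_le_abs_re_add_abs_im _ _).trans ?_
    simp only [gridPt, add_re, add_im]
    have e1 : z.re - (q.re + h * (m : ℝ)) = h * ((z.re - q.re) / h - m) := by field_simp; ring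
    have e2 : z.im - (q.im + h * (n : ℝ)) = h * ((z.im - q.im) / h - n) := by field_simp; ring
    rw [e1, e2, abs_mul, abs_mul, abs_of_pos hh]
    have h1 : |(z.re - q.re) / h - m| ≤ 1 / 2 := abs_sub_round _
    have h2 : |(z.im - q.im) / h - n| ≤ 1 / 2 := abs_sub_round _
    nlinarith

/-- **Two traversals near the endpoint, deterministically.** A curve `γ` with `γ 1 = q` and
`dist (γ 0) q ≥ 5t` crosses the circle of radius `t` about `q`; the crossing point is within `ρ/2`
of a point `x` of the grid of step `ρ/2` (index radius `N ≥ 2t/ρ + 1`), and then `γ` traverses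
`D(x; ρ, t/2)` twice: inwards from the far start, outwards to the endpoint `q`
(`t/2 ≤ |q − x| ≤ 3t/2`). [folklore] -/
theorem exists_hasTraversals_two (γ : Curve ℂ) {q : ℂ} (hq : γ 1 = q) {t ρ : ℝ} (ht : 0 < t)
    (hρ : 0 < ρ) (hρt : ρ ≤ t) (hfar : 5 * t ≤ dist (γ 0) q) {N : ℕ} (hN : 2 * t / ρ + 1 ≤ N) :
    ∃ x ∈ grid q (ρ / 2) N, γ.HasTraversals 2 x ρ (t / 2) := by
  obtain ⟨u, hu0, hu⟩ := exists_dist_eq γ hq ht.le (by linarith)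
  have hN' : t / (ρ / 2) + 1 ≤ N := by
    have : t / (ρ / 2) = 2 * t / ρ := by field_simp
    rw [this]; exact hN
  obtain ⟨x, hx, hzx⟩ := exists_mem_grid_dist_le (half_pos hρ) hN' hu.le
  obtain ⟨u', -, hu'u, hd'⟩ := exists_lt_dist_lt γ hu0 (half_pos hρ)
  -- distances
  have hqx1 : dist q x ≤ t + ρ / 2 := by
    have := dist_triangle q (γ u) x
    rw [dist_comm q (γ u), hu] at this
    linarith
  have hqx2 : t / 2 ≤ dist q x := by
    have := dist_triangle (γ u) q x
    have h' := dist_triangle (γ u) x q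
    rw [hu] at h'
    rw [dist_comm x q] at h'
    linarith
  have h0x : t / 2 ≤ dist (γ 0) x := by
    have := dist_triangle (γ 0) x q
    rw [dist_comm x q] at this
    linarith
  have hu'x : dist (γ u') x ≤ ρ := by
    have := dist_triangle (γ u') (γ u) x
    linarith
  refine ⟨x, hx, ![0, u], ![u', 1], fun i => ?_, fun i j hij => ?_⟩
  · fin_cases i
    · exact ⟨bot_le, Or.inr ⟨h0x, hu'x⟩⟩
    · refine ⟨le_top, Or.inl ⟨by simpa using hzx.trans (by linarith), ?_⟩⟩
      simpa [hq] using hqx2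
  · fin_cases i <;> fin_cases j <;> simp at hij ⊢
    exact hu'u

/-! ## 4. The refutation -/

/-- Arithmetic of the union bound: for `K ≥ 0`, `λ > 2` there is a threshold `u₀ > 0` such that
`324 K u^{λ−2} ≤ 1/2` for all `0 ≤ u ≤ u₀`. [folklore] -/
theorem exists_ratio_small {K lam : ℝ} (hK : 0 ≤ K) (hlam : 2 < lam) :
    ∃ u₀ : ℝ, 0 < u₀ ∧ ∀ u : ℝ, 0 ≤ u → u ≤ u₀ → 324 * K * u ^ (lam - 2) ≤ 1 / 2 := by
  have hl : 0 < lam - 2 := by linarith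
  set c : ℝ := 1 / (648 * (K + 1)) with hc
  have hc0 : 0 < c := by rw [hc]; positivity
  refine ⟨c ^ (lam - 2)⁻¹, Real.rpow_pos_of_pos hc0 _, fun u hu0 hu => ?_⟩
  have h1 : u ^ (lam - 2) ≤ (c ^ (lam - 2)⁻¹) ^ (lam - 2) := Real.rpow_le_rpow hu0 hu hl.le
  rw [Real.rpow_inv_rpow hc0.le hl.ne'] at h1
  have h2 : 324 * K * u ^ (lam - 2) ≤ 324 * K * c := mul_le_mul_of_nonneg_left h1 (by positivity)
  have h3 : 324 * K * c ≤ 1 / 2 := by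
    rw [hc]
    rw [show 324 * K * (1 / (648 * (K + 1))) = K / (K + 1) / 2 by field_simp; ring]
    have : K / (K + 1) ≤ 1 := by
      rw [div_le_one (by linarith)]; linarith
    linarith
  exact h2.trans h3

/-- **Bulk Aizenman–Burchard (H1) with a fixed threshold `k₀ ≤ 2` is FALSE for the critical `ℤ²`
SAW** (the work file's repair candidate `ShellCrossingBoundBulk` with its threshold pinned to
`k₀ ≤ 2`, statement inlined; estimate-free). Witness: the Dobrushin domain `forcingDomain` of
cycle 1 with the endpoint approximation `(aδ, bInt)` whose second point is interior at distance
`≍ √δ`; shells `D(x; δ, √δ/32)` centred on a grid of step `δ/2` about `δ · bInt δ`; union bound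
against the certain crossing of the circle `|z − δ·bInt δ| = √δ/16`, which yields two (hence `k₀`)
separate traversals at some grid point. So a fixed-threshold bulk crux needs `k₀ ≥ 3`
(predicted: `k₀ ≥ 4`). [folklore] -/
theorem not_bulkThreshold_of_le_two {k₀ : ℕ} (hk : k₀ ≤ 2) :
    ¬ (∀ (D : DobrushinDomain) (a b : ℝ → Site 2), SAW.IsEndpointApprox D a b →
      ∃ (K lam δ₀ : ℝ), 2 < lam ∧ 0 < δ₀ ∧ ∀ δ ∈ Set.Ioc (0 : ℝ) δ₀,
        ∀ (x : ℂ) (ρ R : ℝ), δ ≤ ρ → ρ < R → R ≤ 1 → Metric.closedBall x R ⊆ D.carrier →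
          SAW.law D.carrier δ (a δ) (b δ)
            {γ | (⟨γ.walk.toCurve (meshPoint δ)⟩ : Curve ℂ).HasTraversals k₀ x ρ R}
              ≤ ENNReal.ofReal (K * (ρ / R) ^ lam)) := by
  intro hB
  obtain ⟨K, lam, δ₀, hlam, hδ₀, H⟩ := hB forcingDomain aδ bInt isEndpointApprox_int
  -- WLOG `K ≥ 0`
  set K' : ℝ := max K 0 with hK'
  have hK'0 : 0 ≤ K' := le_max_right _ _
  have H' : ∀ δ ∈ Set.Ioc (0 : ℝ) δ₀, ∀ (x : ℂ) (ρ R : ℝ), δ ≤ ρ → ρ < R → R ≤ 1 →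
      Metric.closedBall x R ⊆ forcingDomain.carrier →
        SAW.law forcingDomain.carrier δ (aδ δ) (bInt δ)
          {γ | (⟨γ.walk.toCurve (meshPoint δ)⟩ : Curve ℂ).HasTraversals k₀ x ρ R}
            ≤ ENNReal.ofReal (K' * (ρ / R) ^ lam) := by
    intro δ hδ x ρ R h1 h2 h3 h4
    refine (H δ hδ x ρ R h1 h2 h3 h4).trans (ENNReal.ofReal_le_ofReal ?_)
    have hq : 0 ≤ (ρ / R) ^ lam := Real.rpow_nonneg (div_nonneg (by linarith [hδ.1]) (by linarith [hδ.1])) _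
    exact mul_le_mul_of_nonneg_right (le_max_left _ _) hq
  obtain ⟨u₀, hu₀, hsmall⟩ := exists_ratio_small hK'0 hlam
  -- the mesh: small enough for everything
  set δ : ℝ := min (min δ₀ (dmin 0)) (min (1 / 2500) ((min u₀ 1 / 32) ^ 2)) with hδdef
  have hδ0 : 0 < δ := by
    rw [hδdef]
    refine lt_min (lt_min hδ₀ (dmin_pos 0)) (lt_min (by norm_num) (by positivity))
  have hδδ₀ : δ ≤ δ₀ := (min_le_left _ _).trans (min_le_left _ _)
  have hd0 : δ ≤ dmin 0 := (min_le_left _ _).trans (min_le_right _ _)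
  have h25 : δ ≤ 1 / 2500 := (min_le_right _ _).trans (min_le_left _ _)
  have hδu : δ ≤ (min u₀ 1 / 32) ^ 2 := (min_le_right _ _).trans (min_le_right _ _)
  obtain ⟨hs, hds, hspos⟩ := sqrt_small hδ0 h25
  set s : ℝ := Real.sqrt δ with hsdef
  have hsu : 32 * s ≤ min u₀ 1 := by
    have : s ≤ min u₀ 1 / 32 := by
      rw [hsdef, Real.sqrt_le_left (by positivity)]
      exact hδu
    linarith
  -- scales: circle radius `t = s/16`, shell `D(x; ρ = δ, R = t/2)`, ratio `u = 2ρ/t = 32 √δ`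
  set t : ℝ := s / 16 with htdef
  have ht : 0 < t := by rw [htdef]; positivity
  set ρ : ℝ := δ with hρdef
  have hρ : 0 < ρ := hδ0
  set u : ℝ := ρ / (t / 2) with hudef
  have hu_eq : u = 32 * s := by
    rw [hudef, htdef, hρdef]
    have hss : δ = s * s := by rw [hsdef]; exact (Real.mul_self_sqrt hδ0.le).symm
    rw [hss]; field_simp; ring
  have hu1 : u ≤ 1 := by rw [hu_eq]; exact hsu.trans (min_le_right _ _)
  have huu₀ : u ≤ u₀ := by rw [hu_eq]; exact hsu.trans (min_le_left _ _)
  have hu0 : 0 < u := by rw [hudef]; positivity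
  have hρt : ρ ≤ t := by
    -- `ρ = u t / 2 ≤ t/2`
    have : ρ = u * (t / 2) := by rw [hudef]; field_simp
    rw [this]; nlinarith
  have hρR : ρ < t / 2 := by
    have : ρ = u * (t / 2) := by rw [hudef]; field_simp
    have hu1' : u < 2 := by linarith
    rw [this]; nlinarith
  have hR1 : t / 2 ≤ 1 := by rw [htdef]; linarith
  -- the grid
  set N : ℕ := ⌈2 * t / ρ⌉₊ + 1 with hNdef
  have hN : 2 * t / ρ + 1 ≤ N := by
    rw [hNdef]; push_cast; linarith [Nat.le_ceil (2 * t / ρ)]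
  have hN' : (N : ℝ) ≤ 2 * t / ρ + 2 := by
    rw [hNdef]; push_cast
    have := Nat.ceil_lt_add_one (show 0 ≤ 2 * t / ρ by positivity)
    linarith
  set q : ℂ := meshPoint δ (bInt δ) with hqdef
  set G : Finset ℂ := grid q (ρ / 2) N with hGdef
  -- every grid shell is an interior shell
  have hballq := closedBall_bInt_subset hδ0 h25
  have hGball : ∀ x ∈ G, Metric.closedBall x (t / 2) ⊆ forcingDomain.carrier := by
    intro x hx z hz
    apply hballq
    rw [Metric.mem_closedBall] at hz ⊢
    have hxq : dist x q ≤ 2 * (ρ / 2) * N := dist_le_of_mem_grid (by positivity) hx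
    have h4t : 2 * (ρ / 2) * N ≤ 4 * t := by
      have : 2 * (ρ / 2) * (N : ℝ) ≤ ρ * (2 * t / ρ + 2) := by nlinarith
      have e : ρ * (2 * t / ρ + 2) = 2 * t + 2 * ρ := by field_simp
      linarith
    have := dist_triangle z x q
    show dist z q ≤ s / 2
    have : t = s / 16 := htdef
    linarith
  -- the law is a probability measure and every walk realises the event at some grid point
  have hreach := reachable_dd (good_xres hδ0 hd0) (aδ_mem_RS hδ0 hd0) (bInt_mem_RS hδ0 h25)
  haveI hP := isProbabilityMeasure_law forcingDomain.isBounded hδ0 hreach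
  set P := SAW.law forcingDomain.carrier δ (aδ δ) (bInt δ) with hPdef
  set E : ℂ → Set (SAW.DomainSAW forcingDomain.carrier δ (aδ δ) (bInt δ)) := fun x =>
    {γ | (⟨γ.walk.toCurve (meshPoint δ)⟩ : Curve ℂ).HasTraversals k₀ x ρ (t / 2)} with hEdef
  have hcover : (Set.univ : Set (SAW.DomainSAW forcingDomain.carrier δ (aδ δ) (bInt δ))) ⊆ ⋃ x ∈ G, E x := by
    intro γ _
    set Γ : Curve ℂ := ⟨γ.walk.toCurve (meshPoint δ)⟩ with hΓ
    have hΓ1 : Γ 1 = q := by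
      show γ.walk.toCurve (meshPoint δ) 1 = q
      rw [toCurve_apply_one]
    have hΓ0 : Γ 0 = meshPoint δ (aδ δ) := by
      show γ.walk.toCurve (meshPoint δ) 0 = meshPoint δ (aδ δ)
      rw [SimpleGraph.Walk.toCurve_apply_zero]
    have hfar : 5 * t ≤ dist (Γ 0) q := by
      rw [hΓ0]
      have := dist_endpoints hδ0 hd0 h25
      have : t ≤ 1 / 800 := by rw [htdef]; linarith
      linarith
    obtain ⟨x, hx, htrav⟩ := exists_hasTraversals_two Γ hΓ1 ht hρ hρt hfar hN
    exact Set.mem_biUnion hx (htrav.of_le hk)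
  -- union bound
  have hsum : (1 : ℝ≥0∞) ≤ ∑ x ∈ G, P (E x) := by
    calc (1 : ℝ≥0∞) = P Set.univ := measure_univ.symm
      _ ≤ P (⋃ x ∈ G, E x) := measure_mono hcover
      _ ≤ ∑ x ∈ G, P (E x) := measure_biUnion_finset_le G E
  have hbound : ∀ x ∈ G, P (E x) ≤ ENNReal.ofReal (K' * u ^ lam) := by
    intro x hx
    have := H' δ ⟨hδ0, hδδ₀⟩ x ρ (t / 2) le_rfl hρR hR1 (hGball x hx)
    rwa [← hudef] at this
  have hsum2 : ∑ x ∈ G, P (E x) ≤ ENNReal.ofReal (G.card * (K' * u ^ lam)) := by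
    calc ∑ x ∈ G, P (E x) ≤ ∑ _x ∈ G, ENNReal.ofReal (K' * u ^ lam) := Finset.sum_le_sum hbound
      _ = G.card • ENNReal.ofReal (K' * u ^ lam) := Finset.sum_const _
      _ = ENNReal.ofReal (G.card * (K' * u ^ lam)) := by
          rw [nsmul_eq_mul, ENNReal.ofReal_mul (Nat.cast_nonneg _), ENNReal.ofReal_natCast]
  -- `|G| ≤ 81 (t/ρ)² = 324 / u²`, so the total is `≤ 324 K' u^{λ-2} ≤ 1/2`
  have hcard : (G.card : ℝ) ≤ 324 / u ^ 2 := by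
    have h1 := card_grid_le q (ρ / 2) N
    have h2 : (2 * (N : ℝ) + 1) ≤ 9 * t / ρ := by
      have hρt' : 1 ≤ t / ρ := by rw [le_div_iff₀ hρ]; linarith
      have e4 : 4 * t / ρ = 2 * (2 * t / ρ) := by ring
      have e9 : 9 * t / ρ = 2 * (2 * t / ρ) + 5 * (t / ρ) := by ring
      rw [e9]
      linarith
    have h3 : (2 * (N : ℝ) + 1) ^ 2 ≤ (9 * t / ρ) ^ 2 := pow_le_pow_left₀ (by positivity) h2 2
    have h4 : (9 * t / ρ) ^ 2 = 324 / u ^ 2 := by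
      rw [hudef]; field_simp; ring
    rw [hGdef]
    linarith
  have htotal : (G.card : ℝ) * (K' * u ^ lam) ≤ 1 / 2 := by
    have hsplit : u ^ lam = u ^ (lam - 2) * u ^ 2 := by
      rw [← Real.rpow_two, ← Real.rpow_add hu0]; ring_nf
    have h1 : (G.card : ℝ) * (K' * u ^ lam) ≤ 324 / u ^ 2 * (K' * u ^ lam) :=
      mul_le_mul_of_nonneg_right hcard (mul_nonneg hK'0 (Real.rpow_nonneg hu0.le _))
    have h2 : 324 / u ^ 2 * (K' * u ^ lam) = 324 * K' * u ^ (lam - 2) := by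
      rw [hsplit]; field_simp
    rw [h2] at h1
    exact h1.trans (hsmall u hu0.le huu₀)
  have hlt : ENNReal.ofReal (G.card * (K' * u ^ lam)) < 1 := by
    rw [ENNReal.ofReal_lt_one]; linarith
  exact absurd (hsum.trans hsum2) (not_le.2 hlt)

end Bulk

end Summit.CriticalPhenomena.SAWScalingLimit.Theorems.ShellCrossingBound.Negative

end
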